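import Literature.NumberTheory.Rogawski1990.FinExplicitTransferFactorLeviStratum     -- ★ `endoEmbLocal_eq_glDiagonal_of_fst_eq`, `endoEmbLocal_mem_torusU_of_endoEmbLocal_eq`, `isUnit_finGammaTwo`
import HarnessLib

/-!
# Torus transport under the endoscopic embedding `ι_v : U(Φ₂) × U(Φ₁) → U(Φ₃)` at a finite place: `T₂ × U(Φ₁) ≃ T₃` and `ι_v⁻¹(K₃) = K₂ × K₁`
(Rogawski (1990), §4.8 Case (a) p. 53, §4.9 pp. 54–56 (proof of Lemma 4.9.2: the torus `M` of `G` is the image of the torus of `H`); Platonov–Rapinchuk (1994) §5.1)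

Topic `NumberTheory/Rogawski1990`; namespace `Literature.NumberTheory.Rogawski1990`.  THEOREMS ONLY (no definition, no instance, no notation, no named fact,
no `sorry`).  Cell `pub/hodgecm-mathlib`, line «CMCharIdentityTest» (F0P3b), desk F0P3b-plan (g12) PLAN v14 §10 road to `stub_inducedCharTransfer(Signed)` (Lemma 4.9.2),
sub-brick (T) «TORUS TRANSPORT» for the S4 closer (B-p18 (g32)): the change of variables between the van Dijk ∕ Weyl integration formulas on `H_v` and on `G′_v`.

* §1 `endoGL_mem_glInt_iff` — over a valued field, `ι(g₂, g₁) ∈ GL₃(𝒪)` iff `g₂ ∈ GL₂(𝒪)` and `g₁ ∈ GL₁(𝒪)` (the entries of `ι(g₂, g₁) = (a 0 b; 0 u 0; c 0 d)` and of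
  its inverse `ι(g₂⁻¹, g₁⁻¹)` are those of the blocks; the `⇐` half is ★ `endoGL_mem_glInt`, re-derived privately here to keep the import closure small).
* §2 `localGLPiEquiv_endoEmbLocal` — the `w`-component of `ι_v(γ_H)` is `ι` of the `w`-components; **`endoEmbLocal_mem_cmLocalIntegralLevel_iff`** — at EVERY finite
  place `v` of `L⁺`, `ι_v(γ_H) ∈ K₃ = U(Φ₃)(𝒪_v)` iff `γ_H ∈ K_H = U(Φ₂)(𝒪_v) × U(Φ₁)(𝒪_v)` (★ `mem_localIntegralLevel_iff`: membership is read on every `w ∣ v`;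
  strengthens the `⇐` of ★ `endoEmbLocal_mem_cmLocalIntegralLevel_of_nonsplit`).
* §3 **`exists_leviTorus_continuousMulEquiv`** — `ι_v` restricts to an isomorphism of topological groups `T₂ × U(Φ₁)(L⁺_v) ≃ₜ* T₃` onto the diagonal torus of
  `U(Φ₃)(L⁺_v)`: `(diag(d₀, d₂), d₁) ↦ diag(d₀, d₁, d₂)` (★ `endoEmbLocal_eq_glDiagonal_of_fst_eq`; onto by the torus relations ★
  `glDiagonal_mem_unitaryGroupOfForm_antidiagonal_iff`; a homeomorphism because `ι_v` is a closed embedding, ★ `isClosedEmbedding_endoEmbLocal`); with §2 the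
  closer transports a Haar measure of `T_H` to one of `T₃` and `T_H ∩ K_H` onto `T₃ ∩ K₃`, so the canonically normalised torus integrals agree with NO constant.
* §4 (EDITION 2) **`isLocalGRegular_of_pairwise_isUnit_sub`** ∕ `isLocalGRegular_of_fst_eq_glDiagonal` — `γ_H` is `G`-regular when the entries of `ι_v(γ_H) = diag(d)` have unit
  differences (every `v`; separability of `∏ (X − dᵢ)` from pairwise coprimality): the `hreg : IsLocalGRegular` input of ★ S3-A ∕ ★ (P) in the a.e. currency of ★ (L1).
-/

set_option autoImplicit false

noncomputable section

open MeasureTheory Measure Set Function NumberField IsDedekindDomain Matrix Topology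
open Literature.NumberTheory.Automorphic Literature.NumberTheory.Automorphic.UnitaryGroup
open Literature.NumberTheory.GaloisRepresentations
open scoped Matrix MatrixGroups ValuativeRel

namespace Literature.NumberTheory.Rogawski1990

/-! ## §1 `ι(g₂, g₁) ∈ GL₃(𝒪) ↔ g₂ ∈ GL₂(𝒪) ∧ g₁ ∈ GL₁(𝒪)` over a valued field -/

section GLn

variable {F : Type*} [Field F] [ValuativeRel F]

/-- The blocks of `ι(g₂, g₁) = (a 0 b; 0 u 0; c 0 d)` are read off its entries: integral entries of `ι(g₂, g₁)` give integral entries of `g₂` and `g₁`.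
[cite: Rogawski1990, §4.8 Case (a) p. 53] -/
private theorem forall_apply_mem_integer_of_endoGL {a : GL (Fin 2) F} {b : GL (Fin 1) F}
    (h : ∀ i j, ((endoGL (a, b) : GL (Fin 3) F) : Matrix (Fin 3) (Fin 3) F) i j ∈ 𝒪[F]) :
    (∀ i j, (a : Matrix (Fin 2) (Fin 2) F) i j ∈ 𝒪[F]) ∧ (∀ i j, (b : Matrix (Fin 1) (Fin 1) F) i j ∈ 𝒪[F]) := by
  refine ⟨fun i j => ?_, fun i j => ?_⟩
  · fin_cases i <;> fin_cases j
    · simpa [coe_endoGL_eq] using h 0 0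
    · simpa [coe_endoGL_eq] using h 0 2
    · simpa [coe_endoGL_eq] using h 2 0
    · simpa [coe_endoGL_eq] using h 2 2
  · fin_cases i; fin_cases j; simpa [coe_endoGL_eq] using h 1 1

/-- Conversely the entries of `ι(g₂, g₁)` are entries of the blocks or `0` (local copy of the step behind ★ `endoGL_mem_glInt`, kept private to spare the import).
[cite: Rogawski1990, §4.8 Case (a) p. 53] -/
private theorem forall_endoGL_apply_mem_integer' {a : GL (Fin 2) F} {b : GL (Fin 1) F}
    (ha : ∀ i j, (a : Matrix (Fin 2) (Fin 2) F) i j ∈ 𝒪[F]) (hb : ∀ i j, (b : Matrix (Fin 1) (Fin 1) F) i j ∈ 𝒪[F]) :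
    ∀ i j, ((endoGL (a, b) : GL (Fin 3) F) : Matrix (Fin 3) (Fin 3) F) i j ∈ 𝒪[F] := by
  intro i j
  rw [coe_endoGL_eq]
  fin_cases i <;> fin_cases j <;> simp [ha, hb]

/-- **`ι(g₂, g₁) ∈ GL₃(𝒪) ↔ g₂ ∈ GL₂(𝒪) ∧ g₁ ∈ GL₁(𝒪)`** (★ `glInt`: integral entries and integral inverse; `ι(g₂, g₁)⁻¹ = ι(g₂⁻¹, g₁⁻¹)`; `⇐` is ★
`endoGL_mem_glInt`). [cite: Rogawski1990, §4.8 Case (a) p. 53; §4.9 p. 54] [cite: PlatonovRapinchuk1994, §5.1] -/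
theorem endoGL_mem_glInt_iff (a : GL (Fin 2) F) (b : GL (Fin 1) F) :
    endoGL (a, b) ∈ glInt 3 F ↔ a ∈ glInt 2 F ∧ b ∈ glInt 1 F := by
  constructor
  · intro h
    obtain ⟨h1, h2⟩ := (mem_glInt_iff _).1 h
    rw [← map_inv, Prod.inv_mk] at h2
    obtain ⟨ha1, hb1⟩ := forall_apply_mem_integer_of_endoGL h1
    obtain ⟨ha2, hb2⟩ := forall_apply_mem_integer_of_endoGL h2
    exact ⟨(mem_glInt_iff a).2 ⟨ha1, ha2⟩, (mem_glInt_iff b).2 ⟨hb1, hb2⟩⟩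
  · rintro ⟨ha, hb⟩
    obtain ⟨ha1, ha2⟩ := (mem_glInt_iff a).1 ha
    obtain ⟨hb1, hb2⟩ := (mem_glInt_iff b).1 hb
    refine (mem_glInt_iff _).2 ⟨forall_endoGL_apply_mem_integer' ha1 hb1, ?_⟩
    rw [← map_inv, Prod.inv_mk]
    exact forall_endoGL_apply_mem_integer' ha2 hb2

end GLn

/-! ## §2 `ι_v(γ_H) ∈ K₃ ↔ γ_H ∈ K₂ × K₁` at every finite place -/

section Level

variable (L : Type) [Field L] [NumberField L] [IsCMField L] (v : HeightOneSpectrum (𝓞 ↥(maximalRealSubfield L)))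

/-- **The `w`-component of `ι_v(γ_H)` is `ι` of the `w`-components** (`w ∣ v`; ★ `localGLPiEquiv`, entrywise ★ `localGLPiEquiv_apply_apply`, ★ `coe_endoGL_eq`).
[cite: PlatonovRapinchuk1994, §5.1] [cite: Rogawski1990, §4.8 Case (a) p. 53] -/
theorem localGLPiEquiv_endoEmbLocal
    (γH : (cmDatum L 2 (Matrix.of fun i j : Fin 2 => if i.val + j.val + 1 = 2 then (1 : L) else 0)).Local v ×
      (cmDatum L 1 (Matrix.of fun i j : Fin 1 => if i.val + j.val + 1 = 1 then (1 : L) else 0)).Local v) (w : PlacesOver L v) :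
    localGLPiEquiv L 3 v ((endoEmbLocal L v γH).val : GL (Fin 3) (UnitaryGroup.LocalRing L v)) w =
      endoGL (localGLPiEquiv L 2 v (γH.1.val : GL (Fin 2) (UnitaryGroup.LocalRing L v)) w,
        localGLPiEquiv L 1 v (γH.2.val : GL (Fin 1) (UnitaryGroup.LocalRing L v)) w) := by
  refine Units.ext (Matrix.ext fun i j => ?_)
  rw [localGLPiEquiv_apply_apply, coe_endoEmbLocal, coe_endoGL_eq, coe_endoGL_eq]
  fin_cases i <;> fin_cases j <;> simp [localGLPiEquiv_apply_apply]

/-- **`ι_v(γ_H) ∈ K₃ = U(Φ₃)(𝒪_v)` iff `γ_H ∈ K_H = U(Φ₂)(𝒪_v) × U(Φ₁)(𝒪_v)`**, at EVERY finite place `v` of `L⁺` (membership in the integral levels is read on every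
`w ∣ v`, ★ `mem_localIntegralLevel_iff`, and there blockwise, §1). [cite: Rogawski1990, §4.9 p. 54] [cite: PlatonovRapinchuk1994, §5.1] -/
theorem endoEmbLocal_mem_cmLocalIntegralLevel_iff
    (γH : (cmDatum L 2 (Matrix.of fun i j : Fin 2 => if i.val + j.val + 1 = 2 then (1 : L) else 0)).Local v ×
      (cmDatum L 1 (Matrix.of fun i j : Fin 1 => if i.val + j.val + 1 = 1 then (1 : L) else 0)).Local v) :
    endoEmbLocal L v γH ∈ cmLocalIntegralLevel L 3 (Matrix.of fun i j : Fin 3 => if i.val + j.val + 1 = 3 then (1 : L) else 0) v ↔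
      γH ∈ (cmLocalIntegralLevel L 2 (Matrix.of fun i j : Fin 2 => if i.val + j.val + 1 = 2 then (1 : L) else 0) v).prod
        (cmLocalIntegralLevel L 1 (Matrix.of fun i j : Fin 1 => if i.val + j.val + 1 = 1 then (1 : L) else 0) v) := by
  rw [Subgroup.mem_prod]
  refine (mem_localIntegralLevel_iff (IsCMField.complexConj L) 3 _ v (endoEmbLocal L v γH)).trans ?_
  refine Iff.trans ?_ ((mem_localIntegralLevel_iff (IsCMField.complexConj L) 2 _ v γH.1).and
    (mem_localIntegralLevel_iff (IsCMField.complexConj L) 1 _ v γH.2)).symm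
  rw [← forall_and]
  refine forall_congr' fun w => ?_
  rw [localGLPiEquiv_endoEmbLocal, endoGL_mem_glInt_iff]

end Level

/-! ## §3 `ι_v : T₂ × U(Φ₁)(L⁺_v) ≃ₜ* T₃` -/

section Torus

variable (L : Type) [Field L] [NumberField L] [IsCMField L] (v : HeightOneSpectrum (𝓞 ↥(maximalRealSubfield L)))

/-- **TORUS TRANSPORT UNDER `ι_v`.**  The endoscopic embedding `ι_v : U(Φ₂)(L⁺_v) × U(Φ₁)(L⁺_v) → U(Φ₃)(L⁺_v)` restricts to an isomorphism of topological groups from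
`T_H = T₂ × U(Φ₁)(L⁺_v)` (`T₂` the diagonal torus of `U(Φ₂)`) ONTO the diagonal torus `T₃` of `U(Φ₃)(L⁺_v)`: `ι_v(diag(d₀, d₂), d₁) = diag(d₀, d₁, d₂)` (★
`endoEmbLocal_eq_glDiagonal_of_fst_eq`), every `diag(d₀, d₁, d₂) ∈ U(Φ₃)` arises (torus relations `σ(d₂)d₀ = σ(d₁)d₁ = σ(d₀)d₂ = 1`, ★
`glDiagonal_mem_unitaryGroupOfForm_antidiagonal_iff`), and `ι_v` is a closed embedding (★ `isClosedEmbedding_endoEmbLocal`), so the bijection is a homeomorphism.  This is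
the change of variables «the torus `M` of `G` is `ξ_H` of the torus of `H`» in the proof of Lemma 4.9.2. [cite: Rogawski1990, §4.9 Lemma 4.9.2 p. 56; §4.8 Case (a) p. 53]
[cite: BourbakiGT1, Ch. III §2 no. 1] -/
theorem exists_leviTorus_continuousMulEquiv :
    ∃ e : (↥(torusU (conjLocal L (IsCMField.complexConj L) v) (cmLocalForm L 2 v)) ×
        (cmDatum L 1 (Matrix.of fun i j : Fin 1 => if i.val + j.val + 1 = 1 then (1 : L) else 0)).Local v) ≃ₜ*
        ↥(torusU (conjLocal L (IsCMField.complexConj L) v) (cmLocalForm L 3 v)),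
      ∀ x, ((e x : ↥(torusU (conjLocal L (IsCMField.complexConj L) v) (cmLocalForm L 3 v))) :
          ↥(unitaryGroupOfForm (conjLocal L (IsCMField.complexConj L) v) (cmLocalForm L 3 v))) =
        endoEmbLocal L v ((x.1 : ↥(unitaryGroupOfForm (conjLocal L (IsCMField.complexConj L) v) (cmLocalForm L 2 v))), x.2) := by
  -- the map `f : T_H → T₃`
  have hmem : ∀ x : ↥(torusU (conjLocal L (IsCMField.complexConj L) v) (cmLocalForm L 2 v)) ×
      (cmDatum L 1 (Matrix.of fun i j : Fin 1 => if i.val + j.val + 1 = 1 then (1 : L) else 0)).Local v,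
      (endoEmbLocal L v ((x.1 : ↥(unitaryGroupOfForm (conjLocal L (IsCMField.complexConj L) v) (cmLocalForm L 2 v))), x.2) :
        ↥(unitaryGroupOfForm (conjLocal L (IsCMField.complexConj L) v) (cmLocalForm L 3 v))) ∈
        torusU (conjLocal L (IsCMField.complexConj L) v) (cmLocalForm L 3 v) := by
    intro x
    obtain ⟨d', hd'⟩ := x.1.2
    exact endoEmbLocal_mem_torusU_of_endoEmbLocal_eq L v _ (endoEmbLocal_eq_glDiagonal_of_fst_eq L v (γH := ((x.1 : ↥(unitaryGroupOfForm
      (conjLocal L (IsCMField.complexConj L) v) (cmLocalForm L 2 v))), x.2)) hd')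
  let f : ↥(torusU (conjLocal L (IsCMField.complexConj L) v) (cmLocalForm L 2 v)) ×
      (cmDatum L 1 (Matrix.of fun i j : Fin 1 => if i.val + j.val + 1 = 1 then (1 : L) else 0)).Local v →
      ↥(torusU (conjLocal L (IsCMField.complexConj L) v) (cmLocalForm L 3 v)) := fun x => ⟨_, hmem x⟩
  have hf : ∀ x, ((f x : ↥(torusU (conjLocal L (IsCMField.complexConj L) v) (cmLocalForm L 3 v))) :
      ↥(unitaryGroupOfForm (conjLocal L (IsCMField.complexConj L) v) (cmLocalForm L 3 v))) =
      endoEmbLocal L v ((x.1 : ↥(unitaryGroupOfForm (conjLocal L (IsCMField.complexConj L) v) (cmLocalForm L 2 v))), x.2) := fun _ => rfl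
  -- `f` is an embedding (`ι_v` is a closed embedding)
  have hemb : IsEmbedding f := by
    refine IsEmbedding.subtypeVal.of_comp_iff.mp ?_
    exact (isClosedEmbedding_endoEmbLocal L v).isEmbedding.comp (IsEmbedding.subtypeVal.prodMap IsEmbedding.id)
  -- `f` is onto: `diag(d₀, d₁, d₂) = ι_v(diag(d₀, d₂), d₁)`
  have hsurj : Function.Surjective f := by
    intro t
    obtain ⟨d, hd⟩ := (mem_torusU_iff _).1 t.2
    have hU : glDiagonal 3 (UnitaryGroup.LocalRing L v) d ∈
        unitaryGroupOfForm (conjLocal L (IsCMField.complexConj L) v) ((StdForm.antidiagonal 3).over (UnitaryGroup.LocalRing L v)) := by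
      rw [hd, ← cmLocalForm_eq_over]
      exact (t : ↥(unitaryGroupOfForm (conjLocal L (IsCMField.complexConj L) v) (cmLocalForm L 3 v))).2
    have hrel := (glDiagonal_mem_unitaryGroupOfForm_antidiagonal_iff (conjLocal L (IsCMField.complexConj L) v) 3 d).1 hU
    have h20 : conjLocal L (IsCMField.complexConj L) v (d 2 : UnitaryGroup.LocalRing L v) * (d 0 : UnitaryGroup.LocalRing L v) = 1 := hrel 0
    have h11 : conjLocal L (IsCMField.complexConj L) v (d 1 : UnitaryGroup.LocalRing L v) * (d 1 : UnitaryGroup.LocalRing L v) = 1 := hrel 1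
    have h02 : conjLocal L (IsCMField.complexConj L) v (d 0 : UnitaryGroup.LocalRing L v) * (d 2 : UnitaryGroup.LocalRing L v) = 1 := hrel 2
    have hmem₂ : glDiagonal 2 (UnitaryGroup.LocalRing L v) ![d 0, d 2] ∈
        unitaryGroupOfForm (conjLocal L (IsCMField.complexConj L) v) (cmLocalForm L 2 v) := by
      rw [cmLocalForm_eq_over, glDiagonal_mem_unitaryGroupOfForm_antidiagonal_iff]
      intro i
      fin_cases i
      · exact h20
      · exact h02
    have hmem₁ : glDiagonal 1 (UnitaryGroup.LocalRing L v) ![d 1] ∈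
        unitaryGroupOfForm (conjLocal L (IsCMField.complexConj L) v) (cmLocalForm L 1 v) := by
      rw [cmLocalForm_eq_over, glDiagonal_mem_unitaryGroupOfForm_antidiagonal_iff]
      intro i
      fin_cases i
      exact h11
    let g₂ : ↥(torusU (conjLocal L (IsCMField.complexConj L) v) (cmLocalForm L 2 v)) := ⟨⟨_, hmem₂⟩, ⟨![d 0, d 2], rfl⟩⟩
    let u₁ : (cmDatum L 1 (Matrix.of fun i j : Fin 1 => if i.val + j.val + 1 = 1 then (1 : L) else 0)).Local v := ⟨_, hmem₁⟩
    refine ⟨(g₂, u₁), Subtype.ext (Subtype.ext ?_)⟩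
    -- `ι_v(g₂, u₁) = diag(d)` in `GL₃`
    have hι := endoEmbLocal_eq_glDiagonal_of_fst_eq L v
      (γH := ((g₂ : ↥(unitaryGroupOfForm (conjLocal L (IsCMField.complexConj L) v) (cmLocalForm L 2 v))), u₁)) (d' := ![d 0, d 2]) rfl
    have hu : (isUnit_finGammaTwo L v ((g₂ : ↥(unitaryGroupOfForm (conjLocal L (IsCMField.complexConj L) v) (cmLocalForm L 2 v))), u₁)).unit = d 1 := by
      refine Units.ext ?_
      rw [IsUnit.unit_spec]
      show ((glDiagonal 1 (UnitaryGroup.LocalRing L v) ![d 1] : GL (Fin 1) (UnitaryGroup.LocalRing L v)) :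
        Matrix (Fin 1) (Fin 1) (UnitaryGroup.LocalRing L v)) 0 0 = (d 1 : UnitaryGroup.LocalRing L v)
      rw [coe_glDiagonal, Matrix.diagonal_apply_eq, Matrix.cons_val_fin_one]
    have hvec : (![d 0, (isUnit_finGammaTwo L v ((g₂ : ↥(unitaryGroupOfForm (conjLocal L (IsCMField.complexConj L) v) (cmLocalForm L 2 v))), u₁)).unit, d 2] :
        Fin 3 → (UnitaryGroup.LocalRing L v)ˣ) = d := by
      rw [hu]; funext i; fin_cases i <;> rfl
    rw [hf, hι, ← hd]
    simp only [Matrix.cons_val_zero, Matrix.cons_val_one]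
    rw [hvec]
  -- the homeomorphism and the group structure
  let e₀ := hemb.toHomeomorphOfSurjective hsurj
  have he₀ : ∀ x, e₀ x = f x := fun x => IsEmbedding.toHomeomorphOfSurjective_apply hemb hsurj x
  refine ⟨{ toMulEquiv :=
              { toEquiv := e₀.toEquiv
                map_mul' := fun x y => ?_ }
            continuous_toFun := e₀.continuous
            continuous_invFun := e₀.symm.continuous }, fun x => ?_⟩
  · show e₀ (x * y) = e₀ x * e₀ y
    rw [he₀, he₀, he₀]
    exact Subtype.ext (map_mul (endoEmbLocal L v)
      ((x.1 : ↥(unitaryGroupOfForm (conjLocal L (IsCMField.complexConj L) v) (cmLocalForm L 2 v))), x.2)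
      ((y.1 : ↥(unitaryGroupOfForm (conjLocal L (IsCMField.complexConj L) v) (cmLocalForm L 2 v))), y.2))
  · show ((e₀ x : ↥(torusU (conjLocal L (IsCMField.complexConj L) v) (cmLocalForm L 3 v))) :
        ↥(unitaryGroupOfForm (conjLocal L (IsCMField.complexConj L) v) (cmLocalForm L 3 v))) = _
    rw [he₀]

end Torus

/-! ## §4 (EDITION 2) `G`-regularity on the Levi stratum -/

section Regular

variable (L : Type) [Field L] [NumberField L] [IsCMField L] (v : HeightOneSpectrum (𝓞 ↥(maximalRealSubfield L)))

/-- **`γ_H` is `G`-regular as soon as the diagonal entries of `ι_v(γ_H) = diag(d₀, d₁, d₂)` have UNIT differences** (every `v`, split or not): the characteristic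
polynomial `∏ (X − dᵢ)` of `ι_v(γ_H)` is separable because its factors are pairwise coprime (`dᵢ − dⱼ ∈ R^×`, Mathlib `isCoprime_X_sub_C_of_isUnit_sub`).  This is the
`G`-regularity input (★ `IsLocalGRegular`, canonicity of the `H`-side orbital measures) of Lemma 4.9.2 on the torus, in the a.e. currency of ★ `CMTorusRegularAEPairwise`.
[cite: Rogawski1990, §4.3 p. 42; §4.9 p. 55] -/
theorem isLocalGRegular_of_pairwise_isUnit_sub
    (γH : (cmDatum L 2 (Matrix.of fun i j : Fin 2 => if i.val + j.val + 1 = 2 then (1 : L) else 0)).Local v ×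
      (cmDatum L 1 (Matrix.of fun i j : Fin 1 => if i.val + j.val + 1 = 1 then (1 : L) else 0)).Local v)
    {d : Fin 3 → (UnitaryGroup.LocalRing L v)ˣ}
    (hι : ((endoEmbLocal L v γH).val : GL (Fin 3) (UnitaryGroup.LocalRing L v)) = glDiagonal 3 (UnitaryGroup.LocalRing L v) d)
    (hreg : ∀ i j : Fin 3, i ≠ j → IsUnit ((d i : UnitaryGroup.LocalRing L v) - d j)) : IsLocalGRegular L v γH := by
  show ((((endoEmbLocal L v γH).val : GL (Fin 3) (UnitaryGroup.LocalRing L v)) : Matrix (Fin 3) (Fin 3) (UnitaryGroup.LocalRing L v)).charpoly).Separable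
  rw [hι, coe_glDiagonal, Matrix.charpoly_diagonal]
  exact Polynomial.separable_prod (fun i j hij => Polynomial.isCoprime_X_sub_C_of_isUnit_sub (hreg i j hij)) fun _ => Polynomial.separable_X_sub_C

/-- The same with the Levi-stratum frame of ★ `endoEmbLocal_eq_glDiagonal_of_fst_eq`: `γ_H = (diag(d′₀, d′₁), u)` with `d′₀ − u`, `d′₀ − d′₁`, `u − d′₁` units is `G`-regular.
[cite: Rogawski1990, §4.3 p. 42; §4.9 p. 55] -/
theorem isLocalGRegular_of_fst_eq_glDiagonal
    (γH : (cmDatum L 2 (Matrix.of fun i j : Fin 2 => if i.val + j.val + 1 = 2 then (1 : L) else 0)).Local v ×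
      (cmDatum L 1 (Matrix.of fun i j : Fin 1 => if i.val + j.val + 1 = 1 then (1 : L) else 0)).Local v)
    {d' : Fin 2 → (UnitaryGroup.LocalRing L v)ˣ} (hd' : glDiagonal 2 (UnitaryGroup.LocalRing L v) d' = (γH.1.val : GL (Fin 2) (UnitaryGroup.LocalRing L v)))
    (hreg : ∀ i j : Fin 3, i ≠ j → IsUnit (((![d' 0, (isUnit_finGammaTwo L v γH).unit, d' 1] i : (UnitaryGroup.LocalRing L v)ˣ) : UnitaryGroup.LocalRing L v) -
      ((![d' 0, (isUnit_finGammaTwo L v γH).unit, d' 1] j : (UnitaryGroup.LocalRing L v)ˣ) : UnitaryGroup.LocalRing L v))) :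
    IsLocalGRegular L v γH :=
  isLocalGRegular_of_pairwise_isUnit_sub L v γH (endoEmbLocal_eq_glDiagonal_of_fst_eq L v γH hd') hreg

end Regular

end Literature.NumberTheory.Rogawski1990

end
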